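import Summits.QuantumAdvantage.QuantumAdvantage.Theorems.OrderDialAA

/-! # OrderDialAB — part 2/3 (mechanical split for landing of `OrderDialA`; content verbatim; scopes re-opened with their variables) -/

set_option linter.dupNamespace false
open Finset
open Literature.Computability.MetaComplexity Literature.Computability.MetaComplexity.Smolensky
open Summit.QuantumAdvantage.AdviceFreeQNC0

namespace Summit.QuantumAdvantage.QuantumAdvantage.Theorems.OrderDial
variable {p : ℕ} [Fact p.Prime]

section NullPair
variable {n : ℕ}

/-- relabelling a two-slot strategy relabels its selector. -/
theorem permStrat_pair02 (σ : Equiv.Perm (Fin (n + 2))) (s : (Fin (n + 2) → Bool) → Bool) :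
    permStrat σ (pair02 s) = pair02 (fun u => s (fun i => u (σ i))) := rfl

/-- a two-slot strategy has the degree of its selector. -/
theorem hasDegF_pair02 {s : (Fin (n + 2) → Bool) → Bool} {d : ℕ} (hs : HasDegF p s d) (g : Fin (n + 2 + 1)) :
    HasDegF p (pair02 s g) d := by
  by_cases hg : g.val = 0 ∨ g.val = 2
  · have e : pair02 s g = s := by
      funext u; unfold pair02; rw [decide_eq_true hg, Bool.true_and]
    rw [e]; exact hs
  · have e : pair02 s g = fun _ => false := by
      funext u; unfold pair02; rw [decide_eq_false hg, Bool.false_and]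
    rw [e]; exact RigidityLaws.hasDegF_const p false d

/-- the NULL SELECTOR `[u₀ ≠ u₁]`. -/
def nullSel (u : Fin (n + 2) → Bool) : Bool := Bool.xor (u ⟨0, by omega⟩) (u ⟨1, by omega⟩)

/-- **the null pair** `N`: `[u₀ ≠ u₁]` fired at walk slots 0 and 2. -/
def nullPair : Fin (n + 2 + 1) → (Fin (n + 2) → Bool) → Bool := pair02 nullSel

/-- on the support of the null selector, `W₂ = 1` … -/
theorem wtPrefix_two_of_nullSel (u : Fin (n + 2) → Bool) (h : nullSel u = true) : wtPrefix u 2 = 1 := by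
  rw [wtPrefix_two]
  unfold nullSel at h
  revert h
  cases u ⟨0, by omega⟩ <;> cases u ⟨1, by omega⟩ <;> simp

/-- **INVISIBILITY.**  The null pair never wins the fixed-order game: its two labels agree mod 3 whenever it fires. -/
theorem ringWinU_nullPair (c : ℕ) (u : Fin (n + 2) → Bool) :
    ringWinU c (nullPair : Fin (n + 2 + 1) → (Fin (n + 2) → Bool) → Bool) u = false := by
  rw [show (nullPair : Fin (n + 2 + 1) → (Fin (n + 2) → Bool) → Bool) = pair02 nullSel from rfl, ringWinU_pair02]
  cases hs : nullSel u
  · simp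
  · rw [wtPrefix_two_of_nullSel u hs, show (c + 2 + (wt u + 1)) % 3 = (c + wt u) % 3 by omega]
    simp

/-- its fixed-order win count is 0 … -/
theorem wins_nullPair (c : ℕ) : wins c (nullPair : Fin (n + 2 + 1) → (Fin (n + 2) → Bool) → Bool) = 0 := by
  unfold wins
  simp [ringWinU_nullPair]

/-- … so XOR-ing it into any strategy changes no fixed-order outcome … -/
theorem ringWinU_xor_nullPair (c : ℕ) (y : Fin (n + 2 + 1) → (Fin (n + 2) → Bool) → Bool) (u : Fin (n + 2) → Bool) :
    ringWinU c (RigidityLaws.xorStrat y nullPair) u = ringWinU c y u := by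
  rw [RigidityLaws.ringWinU_xorStrat, ringWinU_nullPair, Bool.xor_false]

/-- … and no fixed-order win count … -/
theorem wins_xor_nullPair (c : ℕ) (y : Fin (n + 2 + 1) → (Fin (n + 2) → Bool) → Bool) :
    wins c (RigidityLaws.xorStrat y nullPair) = wins c y := by
  unfold wins; simp_rw [ringWinU_xor_nullPair]

/-- … at a degree cost of 2: the null selector is a 2-junta … -/
theorem hasDegF_nullSel : HasDegF p (nullSel : (Fin (n + 2) → Bool) → Bool) 2 := by
  have hJ : (({⟨0, by omega⟩, ⟨1, by omega⟩} : Finset (Fin (n + 2))).card) = 2 :=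
    Finset.card_pair (by simp)
  have h := hasDegF_of_junta (p := p) ({⟨0, by omega⟩, ⟨1, by omega⟩} : Finset (Fin (n + 2))) nullSel
    (fun u v huv => by
      simp only [nullSel]
      rw [huv ⟨0, by omega⟩ (by simp), huv ⟨1, by omega⟩ (by simp)])
  rwa [hJ] at h

/-- OrderDialAB helper `hasDegF_nullPair` (decomp-qadv land package; see the module docstring). -/
theorem hasDegF_nullPair {d : ℕ} (hd : 2 ≤ d) (g : Fin (n + 2 + 1)) :
    HasDegF p ((nullPair : Fin (n + 2 + 1) → (Fin (n + 2) → Bool) → Bool) g) d :=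
  hasDegF_pair02 (lowDeg_mono hd hasDegF_nullSel) g

/-- … so `y ⊕ N` is a legal polylog strategy whenever `y` is. -/
theorem hasDegF_xor_nullPair {d : ℕ} {y : Fin (n + 2 + 1) → (Fin (n + 2) → Bool) → Bool}
    (hy : ∀ g, HasDegF p (y g) d) (g : Fin (n + 2 + 1)) :
    HasDegF p (RigidityLaws.xorStrat y nullPair g) (d + 2) :=
  RigidityLaws.hasDegF_xorStrat hy (fun g => hasDegF_nullPair le_rfl g) g

/-! ### The other orders see the null pair -/

/-- flipping one coordinate moves the weight to another residue class mod 3. -/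
theorem wt_flip_mod_three_ne {m : ℕ} (u : Fin m → Bool) (e : Fin m) (c : ℕ) :
    (c + wt (Function.update u e (!u e))) % 3 ≠ (c + wt u) % 3 := by
  have h := wt_update_not u e
  cases he : u e <;> simp [he] at h ⊢ <;> omega

/-- the finite heart: exactly one of the labels `t`, `t + 2 + 2ε` is live when `t ≢ 2 − ε`. -/
private theorem xor_decide_labels (t s : ℕ) (h : (t % 3 = 0 ∧ s % 3 ≠ 0) ∨ (t % 3 ≠ 0 ∧ s % 3 = 0)) :
    Bool.xor (decide (t % 3 ≠ 0)) (decide (s % 3 ≠ 0)) = true := by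
  rcases h with ⟨h1, h2⟩ | ⟨h1, h2⟩ <;> simp [h1, h2]

/-- **VISIBILITY.**  A two-slot strategy whose selector is `[u_a ≠ u_b]` with `a, b ∉ {0, 1}` (what a relabelled null
pair is) wins the fixed-order game on at least `2ⁿ/8` inputs (`n ≥ 5` coordinates): it wins on
`{u_a ≠ u_b} ∩ {u₀ = u₁} ∩ {c + |u| ≢ 2 − u₀ (mod 3)}`, a set of size ≥ 2ⁿ/8 by two halving involutions (flip bit 1,
flip bit b) and one residue-moving injection (flip a fifth bit). -/
theorem wins_pair02_xor_ge (hn : 3 ≤ n) (c : ℕ) (a b : Fin (n + 2)) (hab : a ≠ b)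
    (ha0 : a.val ≠ 0) (ha1 : a.val ≠ 1) (hb0 : b.val ≠ 0) (hb1 : b.val ≠ 1) :
    2 ^ (n + 2) ≤ 8 * wins c (pair02 fun u : Fin (n + 2) → Bool => Bool.xor (u a) (u b)) := by
  classical
  -- the winning criterion
  have hwin : ∀ u : Fin (n + 2) → Bool, u a ≠ u b → u ⟨0, by omega⟩ = u ⟨1, by omega⟩ →
      (c + wt u) % 3 ≠ (if u ⟨0, by omega⟩ = true then 1 else 2) →
      ringWinU c (pair02 fun u : Fin (n + 2) → Bool => Bool.xor (u a) (u b)) u = true := by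
    intro u hne h01 hres
    rw [ringWinU_pair02]
    have hs : Bool.xor (u a) (u b) = true := by
      cases hA : u a <;> cases hB : u b <;> simp_all
    rw [hs, Bool.true_and, wtPrefix_two, ← h01]
    apply xor_decide_labels
    revert hres
    cases u ⟨0, by omega⟩ <;> simp <;> omega
  -- named coordinates and their distinctness
  have h01 : (⟨0, by omega⟩ : Fin (n + 2)) ≠ ⟨1, by omega⟩ := by simp
  have ha0' : a ≠ ⟨0, by omega⟩ := fun h => ha0 (by rw [h])
  have ha1' : a ≠ ⟨1, by omega⟩ := fun h => ha1 (by rw [h])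
  have hb0' : b ≠ ⟨0, by omega⟩ := fun h => hb0 (by rw [h])
  have hb1' : b ≠ ⟨1, by omega⟩ := fun h => hb1 (by rw [h])
  -- a fifth coordinate
  obtain ⟨e, hea, heb, he0, he1⟩ : ∃ e : Fin (n + 2), e ≠ a ∧ e ≠ b ∧ e ≠ ⟨0, by omega⟩ ∧ e ≠ ⟨1, by omega⟩ := by
    have hc : (({a, b, ⟨0, by omega⟩, ⟨1, by omega⟩} : Finset (Fin (n + 2))).card) <
        (univ : Finset (Fin (n + 2))).card := by
      calc (({a, b, ⟨0, by omega⟩, ⟨1, by omega⟩} : Finset (Fin (n + 2))).card) ≤ 4 := Finset.card_le_four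
        _ < n + 2 := by omega
        _ = (univ : Finset (Fin (n + 2))).card := by simp
    obtain ⟨e, -, he⟩ := Finset.exists_mem_notMem_of_card_lt_card hc
    simp only [Finset.mem_insert, Finset.mem_singleton, not_or] at he
    exact ⟨e, he.1, he.2.1, he.2.2.1, he.2.2.2⟩
  -- the nested sets
  set A₁ := (univ : Finset (Fin (n + 2) → Bool)).filter fun u => u ⟨0, by omega⟩ = u ⟨1, by omega⟩ with hA₁
  set A := A₁.filter fun u => u a ≠ u b with hA
  set G := A.filter fun u => (c + wt u) % 3 ≠ (if u ⟨0, by omega⟩ = true then 1 else 2) with hG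
  set B := A.filter fun u => ¬ ((c + wt u) % 3 ≠ (if u ⟨0, by omega⟩ = true then 1 else 2)) with hB
  -- (1) half of the cube has u₀ = u₁ (flip bit 1)
  have h1 : 2 * A₁.card = 2 ^ (n + 2) := by
    have h := Fib19.two_mul_card_filter_of_invol (univ : Finset (Fin (n + 2) → Bool))
      (fun u : Fin (n + 2) → Bool => u ⟨0, by omega⟩ = u ⟨1, by omega⟩)
      (fun u => Function.update u ⟨1, by omega⟩ (!u ⟨1, by omega⟩)) (fun u _ => Finset.mem_univ _)
      (fun u _ => update_not_update_not _ u)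
      (fun u _ => by
        rw [Function.update_of_ne h01, Function.update_self]
        cases u ⟨0, by omega⟩ <;> cases u ⟨1, by omega⟩ <;> simp)
    rw [h]; simp
  -- (2) half of A₁ has u_a ≠ u_b (flip bit b)
  have h2 : 2 * A.card = A₁.card := by
    refine Fib19.two_mul_card_filter_of_invol A₁ (fun u : Fin (n + 2) → Bool => u a ≠ u b)
      (fun u => Function.update u b (!u b)) (fun u hu => ?_) (fun u _ => update_not_update_not _ u) (fun u _ => ?_)
    · simp only [hA₁, Finset.mem_filter, Finset.mem_univ, true_and] at hu ⊢
      rw [Function.update_of_ne hb0'.symm, Function.update_of_ne hb1'.symm]; exact hu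
    · rw [Function.update_of_ne hab, Function.update_self]
      cases u a <;> cases u b <;> simp
  -- (3) the bad residue is the minority in A (flip bit e)
  have h3 : B.card ≤ G.card := by
    refine Finset.card_le_card_of_injOn (fun u => Function.update u e (!u e)) (fun u hu => ?_) ?_
    · simp only [hB, hG, hA, hA₁, Finset.mem_filter, Finset.mem_univ, true_and, not_not,
        Finset.mem_coe] at hu ⊢
      obtain ⟨⟨h01u, habu⟩, hres⟩ := hu
      refine ⟨⟨?_, ?_⟩, ?_⟩
      · rw [Function.update_of_ne he0.symm, Function.update_of_ne he1.symm]; exact h01u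
      · rw [Function.update_of_ne hea.symm, Function.update_of_ne heb.symm]; exact habu
      · rw [Function.update_of_ne he0.symm, ← hres]; exact wt_flip_mod_three_ne u e c
    · intro u _ v _ huv
      have := congrArg (fun w : Fin (n + 2) → Bool => Function.update w e (!w e)) huv
      simpa only [update_not_update_not] using this
  have h4 : G.card + B.card = A.card := Finset.card_filter_add_card_filter_not (s := A) _
  -- (4) G is won
  have h5 : G.card ≤ wins c (pair02 fun u : Fin (n + 2) → Bool => Bool.xor (u a) (u b)) := by
    unfold wins
    refine Finset.card_le_card fun u hu => ?_
    simp only [hG, hA, hA₁, Finset.mem_filter, Finset.mem_univ, true_and] at hu ⊢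
    exact hwin u hu.1.2 hu.1.1 hu.2
  omega

/-- the two double transpositions `(0 k+2)(1 k+3)` used to move a selector pair off `{0, 1}`. -/
def kappa (k : ℕ) (hk : k + 3 < n + 2) : Equiv.Perm (Fin (n + 2)) :=
  Equiv.swap ⟨0, by omega⟩ ⟨k + 2, by omega⟩ * Equiv.swap ⟨1, by omega⟩ ⟨k + 3, hk⟩

/-- OrderDialAB helper `kappa_val` (decomp-qadv land package; see the module docstring). -/
theorem kappa_val (k : ℕ) (hk : k + 3 < n + 2) (x : Fin (n + 2)) :
    ((kappa k hk) x).val =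
      if x.val = 0 then k + 2 else if x.val = k + 2 then 0 else if x.val = 1 then k + 3
        else if x.val = k + 3 then 1 else x.val := by
  unfold kappa
  rw [Equiv.Perm.mul_apply, Equiv.swap_apply_def, Equiv.swap_apply_def]
  obtain ⟨x, hx⟩ := x
  split_ifs <;> simp_all only [Fin.mk.injEq] <;> omega

/-- for every order `σ`, one of `σ`, `κ₀σ`, `κ₂σ` sends both selector coordinates of the null pair off `{0, 1}`. -/
theorem exists_good (hn : 4 ≤ n) (σ : Equiv.Perm (Fin (n + 2))) :
    (2 ≤ (σ ⟨0, by omega⟩).val ∧ 2 ≤ (σ ⟨1, by omega⟩).val) ∨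
    (2 ≤ ((kappa (n := n) 0 (by omega) * σ) ⟨0, by omega⟩).val ∧ 2 ≤ ((kappa (n := n) 0 (by omega) * σ) ⟨1, by omega⟩).val) ∨
    (2 ≤ ((kappa (n := n) 2 (by omega) * σ) ⟨0, by omega⟩).val ∧ 2 ≤ ((kappa (n := n) 2 (by omega) * σ) ⟨1, by omega⟩).val) := by
  have hab : (σ ⟨0, by omega⟩).val ≠ (σ ⟨1, by omega⟩).val := by
    intro h
    have := σ.injective (Fin.ext h)
    simp at this
  have hA := (σ ⟨0, by omega⟩).isLt
  have hB := (σ ⟨1, by omega⟩).isLt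
  simp only [Equiv.Perm.mul_apply, kappa_val]
  generalize (σ ⟨0, by omega⟩).val = A at hab hA ⊢
  generalize (σ ⟨1, by omega⟩).val = B at hab hB ⊢
  split_ifs <;> omega

/-- **ORDER-FRAGILITY OF THE NULL PAIR.**  Summed over all orders the null pair wins at least `n!·2ⁿ/24` (order, input)
pairs (`n ≥ 6` coordinates) — although it wins nothing in the identity order (`wins_nullPair`). -/
theorem symWins_nullPair_ge (hn : 4 ≤ n) (c : ℕ) :
    Nat.factorial (n + 2) * 2 ^ (n + 2) ≤
      24 * symWins c (nullPair : Fin (n + 2 + 1) → (Fin (n + 2) → Bool) → Bool) := by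
  classical
  have hw1 : ∀ τ : Equiv.Perm (Fin (n + 2)), 2 ≤ (τ ⟨0, by omega⟩).val → 2 ≤ (τ ⟨1, by omega⟩).val →
      2 ^ (n + 2) ≤ 8 * wins c (permStrat τ nullPair) := by
    intro τ h0 h1
    have hab : τ ⟨0, by omega⟩ ≠ τ ⟨1, by omega⟩ := by
      intro h
      have := τ.injective h
      simp at this
    rw [show (nullPair : Fin (n + 2 + 1) → (Fin (n + 2) → Bool) → Bool) = pair02 nullSel from rfl, permStrat_pair02]
    exact wins_pair02_xor_ge (by omega) c (τ ⟨0, by omega⟩) (τ ⟨1, by omega⟩) hab (by omega) (by omega)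
      (by omega) (by omega)
  have hgood : ∀ σ : Equiv.Perm (Fin (n + 2)), 2 ^ (n + 2) ≤
      8 * (wins c (permStrat σ nullPair) + wins c (permStrat (kappa (n := n) 0 (by omega) * σ) nullPair) +
        wins c (permStrat (kappa (n := n) 2 (by omega) * σ) nullPair)) := by
    intro σ
    rcases exists_good hn σ with h | h | h
    · have := hw1 σ h.1 h.2; omega
    · have := hw1 _ h.1 h.2; omega
    · have := hw1 _ h.1 h.2; omega
  have e1 : ∑ σ : Equiv.Perm (Fin (n + 2)), wins c (permStrat (kappa (n := n) 0 (by omega) * σ) nullPair) =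
      symWins c (nullPair : Fin (n + 2 + 1) → (Fin (n + 2) → Bool) → Bool) :=
    Fintype.sum_equiv (Equiv.mulLeft (kappa (n := n) 0 (by omega))) _ _ (fun σ => rfl)
  have e2 : ∑ σ : Equiv.Perm (Fin (n + 2)), wins c (permStrat (kappa (n := n) 2 (by omega) * σ) nullPair) =
      symWins c (nullPair : Fin (n + 2 + 1) → (Fin (n + 2) → Bool) → Bool) :=
    Fintype.sum_equiv (Equiv.mulLeft (kappa (n := n) 2 (by omega))) _ _ (fun σ => rfl)
  calc Nat.factorial (n + 2) * 2 ^ (n + 2) = ∑ _σ : Equiv.Perm (Fin (n + 2)), 2 ^ (n + 2) := by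
        rw [Finset.sum_const, Finset.card_univ, Fintype.card_perm, Fintype.card_fin, smul_eq_mul]
    _ ≤ ∑ σ : Equiv.Perm (Fin (n + 2)), 8 * (wins c (permStrat σ nullPair) +
          wins c (permStrat (kappa (n := n) 0 (by omega) * σ) nullPair) +
            wins c (permStrat (kappa (n := n) 2 (by omega) * σ) nullPair)) := Finset.sum_le_sum fun σ _ => hgood σ
    _ = 8 * (symWins c nullPair + symWins c nullPair + symWins c nullPair) := by
        rw [← Finset.mul_sum, Finset.sum_add_distrib, Finset.sum_add_distrib, e1, e2]; rfl
    _ = 24 * symWins c nullPair := by ring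

/-! ### The order-comparison residual is T -/


end NullPair
end Summit.QuantumAdvantage.QuantumAdvantage.Theorems.OrderDial
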